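import Mathlib

/-! # Squaring gadget: stub `stub_ibqSquare` of line `Sketch` (eps-order-ladder) for crux `WordLengthQP` (stmt-ValiantsHypothesis-6623)

We prove the integral (denominator-free) form of the squaring lemma of
Bringmann–Ikenmeyer–Zuiddam for width-2 border programs built from the matrices
`Q(·) = [[·, 1], [1, 0]]`.

A LETTER is `l = ((c, o), m) : (Polynomial ℂ × Option σ) × ℕ`, standing for the `2 × 2` matrix
`[[C c * (o.elim 1 X), C ε^m], [C ε^m, 0]]` over `R = MvPolynomial σ (Polynomial ℂ)`
(`ε := Polynomial.X`).  "`f` has an integral border Q-word of shift `≤ μ`, precision `κ`,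
length `≤ L`" means: some word of at most `L` letters multiplies to
`ε^M • Q(f) + ε^(M+κ) • G` with `M ≤ μ` and `G` integral, where `Q(f) = [[map C f, 1], [1, 0]]`.
This predicate is spelled out as an existential (deliberately no definition).

Main result `stub_ibqSquare`: precision `3` for `f` gives precision `1` for `f ^ 2`, with shift
`2M + 4 ≤ 2μ + 4` and length `≤ 2L + 11`, through the word `A ++ w ++ B' ++ w ++ C` with the
constant gadgets `A = L(-1,1) Q(ε) L(-1,1) = diag(-ε, ε³)`,
`B' = Q(1) Q(-1) Q(1) Q(-ε²) = [[-ε², 1], [-1, 0]]`,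
`C = L(-1,1) Q(ε-1) Q(1) L(1-ε,1) = diag(ε, ε³)` (`L(c,m) = [[c, ε^m], [ε^m, 0]]`,
`Q(c) = L(c,0)`) and the polynomial identity
`A (Q(f) + ε³ G) B' (Q(f) + ε³ G) C = ε⁴ Q(f²) + ε⁵ G'` for an explicit integral matrix `G'`
(`ibqSquare_key`, valid over any commutative ring).

Source: K. Bringmann, C. Ikenmeyer, J. Zuiddam, *On algebraic branching programs of small
width*, J. ACM 65 (2018) art. 32 (CCC 2017, arXiv:1702.05328), §3, Lemma 3.3 (squaring); here
in the `+f²` variant with cleared denominators (our `A`, `C` are `ε²` times theirs).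
Not here: the addition, scalar and `ε ↦ ε³` gadgets (sibling stubs of the same line).
-/

-- `Summit.ValiantsHypothesis.ValiantsHypothesis.…` is the tree's mandated single-conjunct layout (Sub = Summit).
set_option linter.dupNamespace false

noncomputable section

open MvPolynomial

namespace Summit.ValiantsHypothesis.ValiantsHypothesis.Cruxes.WordLengthQP.EpsOrderLadder

/-- The key polynomial identity behind the squaring gadget (BIZ18 Lemma 3.3, integral `+f²`
form), over an arbitrary commutative ring and already multiplied through by the shift `e ^ M`:
`diag(-e, e³) · P · [[-e², 1], [-1, 0]] · P · diag(e, e³) = e^(2M+4) • Q(f²) + e^(2M+5) • G'`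
for `P = e^M • Q(f) + e^(M+3) • G`, with an explicit (integral) error matrix `G'`. -/
private theorem ibqSquare_key {R : Type*} [CommRing R] (e f : R) (M : ℕ)
    (G : Matrix (Fin 2) (Fin 2) R) :
    ∃ G' : Matrix (Fin 2) (Fin 2) R,
      !![-e, 0; 0, e ^ 3] * (e ^ M • !![f, 1; 1, 0] + e ^ (M + 3) • G) * !![-e ^ 2, 1; -1, 0] *
          (e ^ M • !![f, 1; 1, 0] + e ^ (M + 3) • G) * !![e, 0; 0, e ^ 3] =
        e ^ (2 * M + 4) • !![f ^ 2, 1; 1, 0] + e ^ (2 * M + 4 + 1) • G' := by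
  refine ⟨!![e ^ 5 * G 0 0 ^ 2 + e ^ 3 * G 0 0 * G 0 1 - e ^ 3 * G 0 0 * G 1 0
              + 2 * e ^ 2 * f * G 0 0 + f * G 0 1 - f * G 1 0,
            e ^ 7 * G 0 0 * G 0 1 - e ^ 5 * G 0 0 * G 1 1 + e ^ 5 * G 0 1 ^ 2 + e ^ 4 * f * G 0 1
              + e ^ 4 * G 0 0 - e ^ 2 * f * G 1 1 + 2 * e ^ 2 * G 0 1 + e * f;
            -e ^ 7 * G 0 0 * G 1 0 - e ^ 5 * G 0 0 * G 1 1 + e ^ 5 * G 1 0 ^ 2 - e ^ 4 * f * G 1 0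
              - e ^ 4 * G 0 0 - e ^ 2 * f * G 1 1 + 2 * e ^ 2 * G 1 0 - e * f,
            -e ^ 9 * G 0 1 * G 1 0 - e ^ 7 * G 0 1 * G 1 1 + e ^ 7 * G 1 0 * G 1 1 - e ^ 6 * G 0 1
              - e ^ 6 * G 1 0 - e ^ 3], ?_⟩
  ext i j : 1
  fin_cases i <;> fin_cases j <;>
    simp only [Matrix.mul_apply, Matrix.add_apply, Matrix.smul_apply, smul_eq_mul,
      Fin.sum_univ_two] <;> simp <;> ring

/-- Gadget `A = L(-1,1) · Q(ε) · L(-1,1)`: the three constant letters multiply to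
`diag(-ε, ε³)` (this is `ε²` times the matrix `A` of BIZ18 Lemma 3.3). -/
private theorem ibqSquare_prodA {σ : Type} :
    (([((-1, none), 1), ((Polynomial.X, none), 0), ((-1, none), 1)] :
        List ((Polynomial ℂ × Option σ) × ℕ)).map
      (fun l => (!![MvPolynomial.C l.1.1 * l.1.2.elim 1 MvPolynomial.X,
          MvPolynomial.C (Polynomial.X ^ l.2); MvPolynomial.C (Polynomial.X ^ l.2), 0] :
            Matrix (Fin 2) (Fin 2) (MvPolynomial σ (Polynomial ℂ))))).prod
      = !![-(MvPolynomial.C Polynomial.X : MvPolynomial σ (Polynomial ℂ)), 0;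
           0, (MvPolynomial.C Polynomial.X : MvPolynomial σ (Polynomial ℂ)) ^ 3] := by
  simp only [List.map_cons, List.map_nil, List.prod_cons, List.prod_nil, mul_one]
  ext i j : 1
  fin_cases i <;> fin_cases j <;>
    simp only [Matrix.mul_apply, Fin.sum_univ_two] <;> simp <;> ring

/-- Gadget `B' = Q(1) · Q(-1) · Q(1) · Q(-ε²)`: the four constant letters multiply to
`[[-ε², 1], [-1, 0]]` (the `+f²` variant of the matrix `B` of BIZ18 Lemma 3.3). -/
private theorem ibqSquare_prodB {σ : Type} :
    (([((1, none), 0), ((-1, none), 0), ((1, none), 0), ((-(Polynomial.X ^ 2), none), 0)] :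
        List ((Polynomial ℂ × Option σ) × ℕ)).map
      (fun l => (!![MvPolynomial.C l.1.1 * l.1.2.elim 1 MvPolynomial.X,
          MvPolynomial.C (Polynomial.X ^ l.2); MvPolynomial.C (Polynomial.X ^ l.2), 0] :
            Matrix (Fin 2) (Fin 2) (MvPolynomial σ (Polynomial ℂ))))).prod
      = !![-(MvPolynomial.C Polynomial.X : MvPolynomial σ (Polynomial ℂ)) ^ 2, 1; -1, 0] := by
  simp only [List.map_cons, List.map_nil, List.prod_cons, List.prod_nil, mul_one]
  ext i j : 1
  fin_cases i <;> fin_cases j <;>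
    simp only [Matrix.mul_apply, Fin.sum_univ_two] <;> simp <;> ring

/-- Gadget `C = L(-1,1) · Q(ε-1) · Q(1) · L(1-ε,1)`: the four constant letters multiply to
`diag(ε, ε³)` (this is `ε²` times the matrix `C` of BIZ18 Lemma 3.3). -/
private theorem ibqSquare_prodC {σ : Type} :
    (([((-1, none), 1), ((Polynomial.X - 1, none), 0), ((1, none), 0),
          ((1 - Polynomial.X, none), 1)] :
        List ((Polynomial ℂ × Option σ) × ℕ)).map
      (fun l => (!![MvPolynomial.C l.1.1 * l.1.2.elim 1 MvPolynomial.X,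
          MvPolynomial.C (Polynomial.X ^ l.2); MvPolynomial.C (Polynomial.X ^ l.2), 0] :
            Matrix (Fin 2) (Fin 2) (MvPolynomial σ (Polynomial ℂ))))).prod
      = !![(MvPolynomial.C Polynomial.X : MvPolynomial σ (Polynomial ℂ)), 0;
           0, (MvPolynomial.C Polynomial.X : MvPolynomial σ (Polynomial ℂ)) ^ 3] := by
  simp only [List.map_cons, List.map_nil, List.prod_cons, List.prod_nil, mul_one]
  ext i j : 1
  fin_cases i <;> fin_cases j <;>
    simp only [Matrix.mul_apply, Fin.sum_univ_two] <;> simp <;> ring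

/-- **stub_ibqSquare** (BIZ18 Lemma 3.3, squaring, integral form, the `+f²` variant with `B'`):
if `f` has an integral border Q-word `w` of shift `≤ μ`, precision `3` and length `≤ L`, then
`f ^ 2` has one of shift `≤ 2μ + 4`, precision `1` and length `≤ 2L + 11`, namely
`A ++ w ++ B' ++ w ++ C` with the constant gadgets `A = diag(-ε, ε³)`,
`B' = [[-ε², 1], [-1, 0]]`, `C = diag(ε, ε³)` (3 + 4 + 4 letters): its product is
`ε^(2M) • (A (Q(f) + ε³G) B' (Q(f) + ε³G) C) = ε^(2M+4) • Q(f²) + ε^(2M+5) • G'`. -/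
theorem stub_ibqSquare :
    ∀ {σ : Type} (f : MvPolynomial σ ℂ) (μ L : ℕ),
      (∃ w : List ((Polynomial ℂ × Option σ) × ℕ), w.length ≤ L ∧ ∃ M : ℕ, M ≤ μ ∧
        ∃ G : Matrix (Fin 2) (Fin 2) (MvPolynomial σ (Polynomial ℂ)),
          (w.map (fun l => (!![MvPolynomial.C l.1.1 * l.1.2.elim 1 MvPolynomial.X,
              MvPolynomial.C (Polynomial.X ^ l.2); MvPolynomial.C (Polynomial.X ^ l.2), 0] :
                Matrix (Fin 2) (Fin 2) (MvPolynomial σ (Polynomial ℂ))))).prod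
            = (MvPolynomial.C (Polynomial.X ^ M) : MvPolynomial σ (Polynomial ℂ)) •
                (!![MvPolynomial.map Polynomial.C f, 1; 1, 0] :
                  Matrix (Fin 2) (Fin 2) (MvPolynomial σ (Polynomial ℂ)))
              + (MvPolynomial.C (Polynomial.X ^ (M + 3)) : MvPolynomial σ (Polynomial ℂ)) • G) →
      (∃ w : List ((Polynomial ℂ × Option σ) × ℕ), w.length ≤ 2 * L + 11 ∧ ∃ M : ℕ, M ≤ 2 * μ + 4 ∧
        ∃ G : Matrix (Fin 2) (Fin 2) (MvPolynomial σ (Polynomial ℂ)),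
          (w.map (fun l => (!![MvPolynomial.C l.1.1 * l.1.2.elim 1 MvPolynomial.X,
              MvPolynomial.C (Polynomial.X ^ l.2); MvPolynomial.C (Polynomial.X ^ l.2), 0] :
                Matrix (Fin 2) (Fin 2) (MvPolynomial σ (Polynomial ℂ))))).prod
            = (MvPolynomial.C (Polynomial.X ^ M) : MvPolynomial σ (Polynomial ℂ)) •
                (!![MvPolynomial.map Polynomial.C (f ^ 2), 1; 1, 0] :
                  Matrix (Fin 2) (Fin 2) (MvPolynomial σ (Polynomial ℂ)))
              + (MvPolynomial.C (Polynomial.X ^ (M + 1)) : MvPolynomial σ (Polynomial ℂ)) • G) := by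
  intro σ f μ L
  rintro ⟨w, hwL, M, hM, G, hw⟩
  obtain ⟨G', hG'⟩ := ibqSquare_key (MvPolynomial.C Polynomial.X : MvPolynomial σ (Polynomial ℂ))
    (MvPolynomial.map Polynomial.C f) M G
  refine ⟨[((-1, none), 1), ((Polynomial.X, none), 0), ((-1, none), 1)] ++ w ++
      [((1, none), 0), ((-1, none), 0), ((1, none), 0), ((-(Polynomial.X ^ 2), none), 0)] ++ w ++
      [((-1, none), 1), ((Polynomial.X - 1, none), 0), ((1, none), 0),
        ((1 - Polynomial.X, none), 1)],
    ?_, 2 * M + 4, by omega, G', ?_⟩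
  · simp only [List.length_append, List.length_cons, List.length_nil]
    omega
  · simp only [List.map_append, List.prod_append]
    rw [hw, ibqSquare_prodA, ibqSquare_prodB, ibqSquare_prodC]
    simpa only [map_pow] using hG'

end Summit.ValiantsHypothesis.ValiantsHypothesis.Cruxes.WordLengthQP.EpsOrderLadder

end
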